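import Literature.MathematicalPhysics.QuantumFieldTheory.Balaban1983to89.B3Op116CollarKernel
import Literature.MathematicalPhysics.QuantumFieldTheory.Balaban1983to89.B3Op116CollarDict

/-!
# Bałaban, *(Higgs)₂,₃ quantum fields in a finite volume III. Renormalization* [B3] — the kernel of the operator (1.16) p. 414 at
FAR-SEPARATED arguments, file «CollarBinders» of the cell's Route δ (class (c) of p. 433): FROM THE (2.10) DICTIONARY OF THE TWO
PROPAGATORS ON `Ω` TO THE HYPOTHESES OF THE KERNEL ROWS — the value and derivative-type binders of the one-`V_k` collar operator
`(1.16)_{1,0}`, `(1.16)_{0,1}` in p35's `maj` currency, with the `Y`- versus `(P+Y)`-conversions discharged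

statement-level skeleton of published theorems with citation tags; proofs where landed; nothing here is a claim about the Yang–Mills mass gap

T. Bałaban, Commun. Math. Phys. **88** (1983) 411–445 [cite: Balaban1983Higgs3]; part I, Commun. Math. Phys. **85** (1982) 603–636
[cite: Balaban1982Higgs1].  PDFs held: `paper:balaban1983-higgs-2-3-quantum-fields-finite-volume` (journal page = PDF page + 410;
p. 414 = `p0004.txt`, p. 426 = `p0016.txt`, p. 433 = `p0023.txt`), `paper:balaban1982-cmp85-higgs23-i` (p. 615 = `p0013.txt`).

CITATION HEADER (lean-in-tree rule).  Cell `lit-balaban` (HOME `run/shared/lean/pub/lit-balaban/`), Phase-2 proof seat **p40** gen 77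
(unit `lit-balaban-p40`, literature-prover-lit-balaban-p40-g77-0); free-target protocol G.5-34(d), TAKING line HOME/STATUS.md
2026-08-23T12:41:06Z (cc r15 = fold owner of rows B3.Txt@433 / B3.Prop1 / B3.Eq1.16 / B3.Eq2.5 / B3.Eq2.10, p35, r14, p33); design note
`lit-balaban-p40/DESIGN-B3-116-box.md` v3 §5/§5.1 (Route δ; HOME/GAPS.md «G-B3-16 ADDENDUM 1», owner note l.2887).  LOCATED SUPPORT FILE —
no head claim.  USED BY NAME, never restated: p40 g77's `B3Op116CollarKernel.{value_row_op116_one_zero_le, value_row_op116_zero_one_le,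
deriv_row_op116_one_zero_le, deriv_row_op116_zero_one_le}` (F3), `B3Op116CollarDict.{covDeriv_eq_covDeriv_add, sum_norm_covDeriv_le_add,
dip_add_eq, norm_dipCharge_le, apply_eq_zero_of_far_src}`, `B3Op116CollarSources.{collB, mem_collB, propagatorK_cb_apply_eq_zero_of_not_mem,
propagatorK_cb_apply_eq_zero_of_mem, covDeriv_propagatorK_cb_eq_zero_of_not_mem}`, `B3Op116CollarRows.{Far, top, farF, collarC}`, p35's
`B3Op116MajorantStep.{maj, maj_nonneg, maj_add, mul_maj, maj_comm, maj_shift_left, maj_shift_right, maj_exponent_reduce, maj_const_mono}`,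
r14's `B3Op116SourceForm.{covDerivAt, norm_mapE_single_le}`, `B3Ineq210MixedRegularTorus.{dip, onb, norm_onb}`, the typer's carriers.

## What is printed

[B3] p. 414 [PDF 4]: *"a kernel of the operator (1.16) is a sufficiently regular function of both variables … This estimate follows
easily from the properties of the propagators G_k(Ω, A) proved in the next paper"*; p. 426 (2.10) [PDF 16]:
*"|G_k^{(j)}(Ω,B;x,x′)| ≤ O(1)(L^jη)^{−d+2}e^{−δ₁(L^jη)^{−1}|x−x′|} and if the propagator is differentiated, then for each differentiation,
there is an additional factor (L^jη)^{−1} on the right side"*; p. 433 [PDF 23] (class (c)): *"We have B̃ = B̃₀ + B̃′, and we expand in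
B̃′ … we include the operators (1.16) … into the external fields"*.

## What this file proves, and how

§1 CONVERSIONS on a `k`-block union `Ω` (`m² > 0`, `a_k ≥ 0`): a (2.10) column bound at the sources `y ∈ Ω` holds at every `y` (the
columns of sources off `Ω` vanish on `Ω`), a state column from `x′ ∈ Ω` vanishes off `Ω`, a differentiated column at a bond `⊂ Ω`
likewise (`col_row_all`, `col_state_all`, `dcol_row_all`); the `Y`-derivative of a family at a collar bond from its `(P+Y)`-derivative
and its values (`sum_dY_le_maj`: `Σ‖D^ε_Yφ_i(b)‖ ≤ 𝔪(c_d + e·c_v·L^kε·|e|s, 1)(b₋,x′)`, p40's `sum_norm_covDeriv_le_add` + p35's shift and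
exponent reductions); the twice-differentiated entry with a `Y`-dipole from the `(P+Y)`-mixed dictionary entry and a differentiated column
(`mixed_dY_le_maj`, p40's `dip_add_eq` + `norm_dipCharge_le`).
§2 **THE VALUE BINDERS** `value_binder_one_zero` / `value_binder_zero_one`: at `x, x′ ∈ Ω` far from `supp P` (every site of a `k`-block
met by `supp P` is `ρL^k`-far from `x` and from `x′`), GIVEN the (2.10) value and differentiated columns of `G_k(Ω,Y)` (with `D^ε_Y`) and
of `G_k(Ω,P+Y)` (with `D^ε_{P+Y}`) between points of `Ω` in `maj` currency (p35 g21's `B3Op116BoxRows.colB_dcolB_le` on a cell-product box),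
`Σ_{i′}‖((1.16)_{1,0}e_{(x′,i′)})(x)‖` and `Σ_{i′}‖((1.16)_{0,1}e_{(x′,i′)})(x)‖` are `≤ top_k(farF·collarC(…), 3; δ/4)(x,x′)`.
§3 **THE ROW-DERIVATIVE BINDERS** `deriv_binder_one_zero` / `deriv_binder_zero_one` at a bond `b₀ ⊂ Ω` from a far point, GIVEN in
addition the mixed (twice-differentiated) dictionary entries between bonds `⊂ Ω` (p40's `B3Op116CollarDict.mixedB_le`):
`Σ_{i′}‖(D^ε_Y(1.16)_{n,n′}e_{(x′,i′)})(b₀)‖ ≤ top_k(farF·collarC(…), 2; δ/4)(b₀₋,x′)`.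
§4 **THE MIXED BINDERS** `mixed_binder_one_zero` / `mixed_binder_zero_one` at bonds `b₀, c ⊂ Ω` from far points (dipole test source; the
dipole-sourced states read anywhere are differentiated columns, `dip_state_all`; their `Y`-derivatives at the collar bonds,
`mixed_collar_dY_le_maj`): `ε^{−1}Σ_i‖(D^ε_Y(1.16)_{n,n′}dip^Y_ce_i)(b₀)‖ ≤ top_k(farF·collarC(…), 1; δ/4)(b₀₋,c₋)`.

## Honest scope

(B)-level plug: the dictionary entries are HYPOTHESES in the exact output shapes of `colB_dcolB_le` / `mixed_le_of_pieces` (value exponent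
`2`, derivative `1`, mixed `0`, one rate `δ`), for the two backgrounds `Y` and `P + Y`; `Ω` any `k`-block union; constants explicit.  NOT
here: the conversion of `top` to the binder currency and the `Ineq25At 1 0 0` member (`B3Ineq25Op116CollarRegion`, p40 g77), the
`(C)`-level packaging (`∃ K₀,min ∀ K₀ ∃ t δ₁ C`) on `Ω = cellBox k K₀ S` with both backgrounds regular (successor), the Hölder binders for
`α > 0` (F4 `B3Op116CollarHolder` + the near/far split, successor).  The class-(c) use on `□` is a RECORDED
ROUTE DEVIATION from p. 433 l.12–15 (G-B3-16.A1).  Theorems only: no `def`, no `def … : Prop`, no new named fact, no `sorry`; axioms standard.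
-/

noncomputable section

open scoped BigOperators

namespace Literature.MathematicalPhysics.QuantumFieldTheory.Balaban1983to89.B3Op116CollarBinders

open HiggsLattice (ChargeData ScalarField covDeriv)
open HiggsCovariance (propagatorK E)
open HiggsCovariancePos (Inside)
open HiggsAveraging (blockK blockIter)
open B1Eq230FluctCov (Ix cb)
open B3Ineq210MixedRegularTorus (onb dip norm_onb)
open B3Eq116TwoSidedExpansion (op116)
open B3Op116SourceForm (covDerivAt covDerivAt_apply norm_mapE_single_le)
open B3Op116MajorantStep (maj maj_nonneg maj_add mul_maj maj_comm maj_shift_left maj_shift_right maj_exponent_reduce maj_const_mono)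
open B3Op116CollarRows (Far top farF collarC)
open B3Op116CollarSources (collB mem_collB propagatorK_cb_apply_eq_zero_of_not_mem propagatorK_cb_apply_eq_zero_of_mem
  covDeriv_propagatorK_cb_eq_zero_of_not_mem)
open B3Op116CollarDict (covDeriv_eq_covDeriv_add sum_norm_covDeriv_le_add dip_add_eq norm_dipCharge_le apply_eq_zero_of_far_src)
open B3Op116CollarKernel (value_row_op116_one_zero_le value_row_op116_zero_one_le deriv_row_op116_one_zero_le deriv_row_op116_zero_one_le)

variable {P : HiggsLattice.Params} {N : ℕ}

/-! ## §1 Conversions -/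

section Conv

variable (C : ChargeData N) (Ω : Finset (HiggsLattice.Site P 0)) (X : HiggsLattice.VecField P 0) {msq : ℝ} (a : ℝ) {k : ℕ}
  (hmsq : 0 < msq) (hak : 0 ≤ B1.aSeq a P.L k)
  (hΩ : ∀ x x' : HiggsLattice.Site P 0, blockIter k x = blockIter k x' → (x ∈ Ω ↔ x' ∈ Ω))
include hmsq hak hΩ

/-- A column bound of `G_k(Ω,X)` read at `x ∈ Ω` for the sources in `Ω` holds for every source (block-diagonality: the columns of the
sources off `Ω` vanish on `Ω`). [cite: Balaban1982Higgs1, (2.20) p.610] [cite: Balaban1983Higgs3, (2.10) p.426] -/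
theorem col_row_all {x : HiggsLattice.Site P 0} (hx : x ∈ Ω) {c a' δ : ℝ} (hc : 0 ≤ c)
    (hcol : ∀ y ∈ Ω, ∑ i : Ix N, ‖propagatorK C Ω X msq a k (cb P N 0 (y, i)) x‖ ≤ maj P k c a' δ x y) (y : HiggsLattice.Site P 0) :
    ∑ i : Ix N, ‖propagatorK C Ω X msq a k (cb P N 0 (y, i)) x‖ ≤ maj P k c a' δ x y := by
  by_cases hy : y ∈ Ω
  · exact hcol y hy
  · refine le_of_eq_of_le (Finset.sum_eq_zero fun i _ => ?_) (maj_nonneg hc x y)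
    rw [propagatorK_cb_apply_eq_zero_of_not_mem C Ω X a hmsq hak hΩ hy hx i, norm_zero]

/-- A state column of `G_k(Ω,X)` from `x′ ∈ Ω`, bounded on `Ω`, is bounded everywhere (it vanishes off `Ω`).
[cite: Balaban1982Higgs1, (2.20) p.610] [cite: Balaban1983Higgs3, (2.10) p.426] -/
theorem col_state_all {x' : HiggsLattice.Site P 0} (hx' : x' ∈ Ω) {c a' δ : ℝ} (hc : 0 ≤ c)
    (hcol : ∀ u ∈ Ω, ∑ i' : Ix N, ‖propagatorK C Ω X msq a k (cb P N 0 (x', i')) u‖ ≤ maj P k c a' δ u x') (u : HiggsLattice.Site P 0) :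
    ∑ i' : Ix N, ‖propagatorK C Ω X msq a k (cb P N 0 (x', i')) u‖ ≤ maj P k c a' δ u x' := by
  by_cases hu : u ∈ Ω
  · exact hcol u hu
  · refine le_of_eq_of_le (Finset.sum_eq_zero fun i _ => ?_) (maj_nonneg hc u x')
    rw [propagatorK_cb_apply_eq_zero_of_mem C Ω X a hmsq hak hΩ hx' hu i, norm_zero]

/-- A differentiated-column bound (any derivative background `X′`) at a bond `b₀ ⊂ Ω` for the sources in `Ω` holds for every source.
[cite: Balaban1982Higgs1, (1.7) p.605, (2.20) p.610] [cite: Balaban1983Higgs3, (2.10) p.426] -/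
theorem dcol_row_all (X' : HiggsLattice.VecField P 0) {b₀ : HiggsLattice.PBond P 0} (hb₀ : Inside Ω b₀) {c a' δ : ℝ} (hc : 0 ≤ c)
    (hdcol : ∀ y ∈ Ω, ∑ i : Ix N, ‖covDeriv C X' (propagatorK C Ω X msq a k (cb P N 0 (y, i))) b₀‖ ≤ maj P k c a' δ b₀.src y)
    (y : HiggsLattice.Site P 0) :
    ∑ i : Ix N, ‖covDeriv C X' (propagatorK C Ω X msq a k (cb P N 0 (y, i))) b₀‖ ≤ maj P k c a' δ b₀.src y := by
  by_cases hy : y ∈ Ω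
  · exact hdcol y hy
  · refine le_of_eq_of_le (Finset.sum_eq_zero fun i _ => ?_) (maj_nonneg hc _ y)
    rw [covDeriv_propagatorK_cb_eq_zero_of_not_mem C Ω X a hmsq hak hΩ X' hy hb₀ i, norm_zero]

end Conv

section ConvP

variable (C : ChargeData N) (Pf Y : HiggsLattice.VecField P 0) {k : ℕ}

/-- **The `Y`-derivatives of a family at a collar bond from its `(P+Y)`-derivatives and its values** (`0 < δ ≤ 1`, `sup|P| ≤ s`):
`Σ_i‖D^ε_Yφ_i(b)‖ ≤ 𝔪_k(c_d,1;δ)(b₋,x′) + |e|s·Σ_i‖φ_i(b₊)‖ ≤ 𝔪_k(c_d + e·c_v·L^kε·|e|s, 1; δ)(b₋,x′)` when the `(P+Y)`-derivatives are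
`≤ 𝔪_k(c_d,1)(b₋,x′)` and the values at `b₊` are `≤ 𝔪_k(c_v,2)(b₊,x′)` (p35's shift `b₊ → b₋` and one power of the scale).
[cite: Balaban1982Higgs1, (1.7) p.605, (3.14) p.614] [cite: Balaban1983Higgs3, (2.10) p.426, p.433] -/
theorem sum_dY_le_maj {δ s cv cd : ℝ} (hδ : 0 < δ) (hδ1 : δ ≤ 1) (hs : 0 ≤ s) (hcv : 0 ≤ cv)
    (hP : ∀ b : HiggsLattice.PBond P 0, |Pf b| ≤ s) {ι : Type*} (S : Finset ι) (φ : ι → ScalarField P 0 N)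
    (b : HiggsLattice.PBond P 0) (x' : HiggsLattice.Site P 0)
    (hd : ∑ i ∈ S, ‖covDeriv C (Pf + Y) (φ i) b‖ ≤ maj P k cd 1 δ b.src x')
    (hv : ∑ i ∈ S, ‖φ i b.tgt‖ ≤ maj P k cv 2 δ b.tgt x') :
    ∑ i ∈ S, ‖covDeriv C Y (φ i) b‖ ≤ maj P k (cd + Real.exp 1 * cv * P.mesh k * (|C.e| * s)) 1 δ b.src x' := by
  have hes : 0 ≤ |C.e| * s := mul_nonneg (abs_nonneg _) hs
  have h1 := sum_norm_covDeriv_le_add C Pf Y (hP b) S φ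
  have h2 : ∑ i ∈ S, ‖φ i b.tgt‖ ≤ maj P k (Real.exp 1 * cv * P.mesh k) 1 δ b.src x' := by
    refine hv.trans ?_
    have h3 : maj P k cv 2 δ b.tgt x' ≤ maj P k (Real.exp 1 * cv) 2 δ b.src x' := maj_shift_left hδ hδ1 hcv b.src x' b.dir
    refine h3.trans ?_
    have h4 := maj_exponent_reduce (k := k) (a := (2 : ℝ)) (δ := δ) (mul_nonneg (Real.exp_pos 1).le hcv) b.src x'
    rwa [show (2 : ℝ) - 1 = 1 by norm_num] at h4
  calc ∑ i ∈ S, ‖covDeriv C Y (φ i) b‖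
      ≤ maj P k cd 1 δ b.src x' + |C.e| * s * maj P k (Real.exp 1 * cv * P.mesh k) 1 δ b.src x' :=
        h1.trans (add_le_add hd (mul_le_mul_of_nonneg_left h2 hes))
    _ = maj P k (cd + Real.exp 1 * cv * P.mesh k * (|C.e| * s)) 1 δ b.src x' := by
        rw [mul_maj, maj_add]; ring_nf

variable (Ω : Finset (HiggsLattice.Site P 0)) (X : HiggsLattice.VecField P 0) (msq a : ℝ)

/-- **The twice-differentiated entry with a `Y`-dipole from the `(P+Y)` entries** at a bond `b₀` with `P_{b₀} = 0` (`0 < δ ≤ 1`,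
`sup|P| ≤ s`): `ε^{−1}Σ_i‖(D^ε_YG_k(Ω,X)dip^Y_be_i)(b₀)‖ ≤ ε^{−1}Σ_i‖(D^ε_{P+Y}G_kdip^{P+Y}_be_i)(b₀)‖ + |e||P_b|·N·Σ_{i′}‖(D^ε_{P+Y}G_ke_{(b₊,i′)})(b₀)‖`
(`dip^{P+Y}_b = dip^Y_b + δ_{b₊}(U(−ε(P+Y)_b) − U(−εY_b))`, the extra charge `≤ ε|e||P_b|`), hence `≤ 𝔪_k(c_m + e·c_K·L^kε·|e|s·N, 0; δ)(b₋,b₀₋)`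
when the mixed entry is `≤ 𝔪_k(c_m,0)(b₀₋,b₋)` and the differentiated column `≤ 𝔪_k(c_K,1)(b₀₋,b₊)`.
[cite: Balaban1982Higgs1, (1.7) p.605, (3.14) p.614] [cite: Balaban1983Higgs3, (2.10) p.426, p.433] -/
theorem mixed_dY_le_maj {δ s cm cK : ℝ} (hδ : 0 < δ) (hδ1 : δ ≤ 1) (hs : 0 ≤ s) (hcK : 0 ≤ cK)
    (hP : ∀ b : HiggsLattice.PBond P 0, |Pf b| ≤ s) {b₀ b : HiggsLattice.PBond P 0} (hb₀ : Pf b₀ = 0)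
    (hmix : (P.mesh 0)⁻¹ * ∑ i : Ix N, ‖covDeriv C (Pf + Y) (propagatorK C Ω X msq a k (dip C (Pf + Y) b (onb N i))) b₀‖
      ≤ maj P k cm 0 δ b₀.src b.src)
    (hdcol : ∑ i : Ix N, ‖covDeriv C (Pf + Y) (propagatorK C Ω X msq a k (cb P N 0 (b.tgt, i))) b₀‖ ≤ maj P k cK 1 δ b₀.src b.tgt) :
    (P.mesh 0)⁻¹ * ∑ i : Ix N, ‖covDeriv C Y (propagatorK C Ω X msq a k (dip C Y b (onb N i))) b₀‖
      ≤ maj P k (cm + Real.exp 1 * cK * P.mesh k * (|C.e| * s * (Fintype.card (Ix N) : ℝ))) 0 δ b.src b₀.src := by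
  have hε : 0 < P.mesh 0 := P.mesh_pos 0
  have hes : 0 ≤ |C.e| * s := mul_nonneg (abs_nonneg _) hs
  set T : ScalarField P 0 N →ₗ[ℝ] E N := covDerivAt C (Pf + Y) b₀ ∘ₗ
    (propagatorK C Ω X msq a k : ScalarField P 0 N →ₗ[ℝ] ScalarField P 0 N) with hT
  set κ : ℝ := ∑ i : Ix N, ‖covDeriv C (Pf + Y) (propagatorK C Ω X msq a k (cb P N 0 (b.tgt, i))) b₀‖ with hκ
  have hκ0 : 0 ≤ κ := Finset.sum_nonneg fun _ _ => norm_nonneg _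
  -- per internal index: `D_Y → D_{P+Y}` at `b₀` (exact), `dip^Y = dip^{P+Y} − δ_{b₊}(extra charge)`
  have hper : ∀ i : Ix N, ‖covDeriv C Y (propagatorK C Ω X msq a k (dip C Y b (onb N i))) b₀‖
      ≤ ‖covDeriv C (Pf + Y) (propagatorK C Ω X msq a k (dip C (Pf + Y) b (onb N i))) b₀‖ + P.mesh 0 * (|C.e| * s) * κ := by
    intro i
    rw [covDeriv_eq_covDeriv_add C Pf Y hb₀]
    have hd : dip C Y b (onb N i) = dip C (Pf + Y) b (onb N i)
        - Pi.single b.tgt (C.U (P.mesh 0) (-((Pf + Y) b)) (onb N i) - C.U (P.mesh 0) (-(Y b)) (onb N i)) := by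
      rw [dip_add_eq C Pf Y b (onb N i)]; abel
    have e1 : covDeriv C (Pf + Y) (propagatorK C Ω X msq a k (dip C Y b (onb N i))) b₀
        = T (dip C (Pf + Y) b (onb N i))
          - T (Pi.single b.tgt (C.U (P.mesh 0) (-((Pf + Y) b)) (onb N i) - C.U (P.mesh 0) (-(Y b)) (onb N i))) := by
      rw [← map_sub, ← hd, hT, LinearMap.coe_comp, Function.comp_apply, covDerivAt_apply]
    have e2 : covDeriv C (Pf + Y) (propagatorK C Ω X msq a k (dip C (Pf + Y) b (onb N i))) b₀ = T (dip C (Pf + Y) b (onb N i)) := by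
      rw [hT, LinearMap.coe_comp, Function.comp_apply, covDerivAt_apply]
    rw [e1, e2]
    refine (norm_sub_le _ _).trans (add_le_add le_rfl ?_)
    refine (norm_mapE_single_le T b.tgt _).trans ?_
    have hq : ‖C.U (P.mesh 0) (-((Pf + Y) b)) (onb N i) - C.U (P.mesh 0) (-(Y b)) (onb N i)‖ ≤ P.mesh 0 * (|C.e| * s) := by
      refine (norm_dipCharge_le C Pf Y b (onb N i)).trans ?_
      rw [norm_onb, mul_one, abs_mul, abs_mul, abs_of_pos hε, mul_assoc]
      exact mul_le_mul_of_nonneg_left (mul_le_mul_of_nonneg_left (hP b) (abs_nonneg _)) hε.le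
    have hκ' : ∑ i' : Ix N, ‖T (cb P N 0 (b.tgt, i'))‖ = κ := by
      simp only [hT, hκ, LinearMap.coe_comp, Function.comp_apply, covDerivAt_apply]
    rw [hκ']
    exact mul_le_mul_of_nonneg_right hq hκ0
  -- sum, weight by `ε⁻¹`
  have hsum : (P.mesh 0)⁻¹ * ∑ i : Ix N, ‖covDeriv C Y (propagatorK C Ω X msq a k (dip C Y b (onb N i))) b₀‖
      ≤ (P.mesh 0)⁻¹ * ∑ i : Ix N, ‖covDeriv C (Pf + Y) (propagatorK C Ω X msq a k (dip C (Pf + Y) b (onb N i))) b₀‖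
        + |C.e| * s * (Fintype.card (Ix N) : ℝ) * κ := by
    refine (mul_le_mul_of_nonneg_left (Finset.sum_le_sum fun i _ => hper i) (inv_nonneg.mpr hε.le)).trans (le_of_eq ?_)
    rw [Finset.sum_add_distrib, Finset.sum_const, Finset.card_univ, nsmul_eq_mul, mul_add]
    field_simp
  -- the differentiated column: shift `b₊ → b₋` in the second site and one power of the scale
  have hcol : κ ≤ maj P k (Real.exp 1 * cK * P.mesh k) 0 δ b₀.src b.src := by
    refine hdcol.trans ((maj_shift_right hδ hδ1 hcK b₀.src b.src b.dir).trans ?_)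
    have h4 := maj_exponent_reduce (k := k) (a := (1 : ℝ)) (δ := δ) (mul_nonneg (Real.exp_pos 1).le hcK) b₀.src b.src
    rwa [show (1 : ℝ) - 1 = 0 by norm_num] at h4
  have hc0 : 0 ≤ |C.e| * s * (Fintype.card (Ix N) : ℝ) := mul_nonneg hes (Nat.cast_nonneg _)
  calc (P.mesh 0)⁻¹ * ∑ i : Ix N, ‖covDeriv C Y (propagatorK C Ω X msq a k (dip C Y b (onb N i))) b₀‖
      ≤ maj P k cm 0 δ b₀.src b.src + |C.e| * s * (Fintype.card (Ix N) : ℝ) * maj P k (Real.exp 1 * cK * P.mesh k) 0 δ b₀.src b.src :=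
        hsum.trans (add_le_add hmix (mul_le_mul_of_nonneg_left hcol hc0))
    _ = maj P k (cm + Real.exp 1 * cK * P.mesh k * (|C.e| * s * (Fintype.card (Ix N) : ℝ))) 0 δ b.src b₀.src := by
        rw [mul_maj, maj_add, maj_comm]; ring_nf


/-- **A dipole test source through `G_k(Ω,X)`, read anywhere, is a differentiated column** (r14's `norm_propagatorK_dip_apply_le`, summed
over the internal basis; block-diagonality off `Ω`): if `Σ_{i′}‖(D^ε_{X′}G_k(Ω,X)e_{(u,i′)})(c)‖ ≤ 𝔪_k(c_D,1;δ)(c₋,u)` for `u ∈ Ω` (`c ⊂ Ω`), then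
`ε^{−1}Σ_i‖(G_k(Ω,X)dip^{X′}_ce_i)(u)‖ ≤ 𝔪_k(N·c_D,1;δ)(u,c₋)` for every `u`. [cite: Balaban1982Higgs1, (1.7) p.605, (2.20) p.610] [cite: Balaban1983Higgs3, (2.10) p.426] -/
theorem dip_state_all (hmsq : 0 < msq) (hak : 0 ≤ B1.aSeq a P.L k)
    (hΩ : ∀ x x' : HiggsLattice.Site P 0, blockIter k x = blockIter k x' → (x ∈ Ω ↔ x' ∈ Ω))
    (X' : HiggsLattice.VecField P 0) {c : HiggsLattice.PBond P 0} (hc : Inside Ω c) {cD δ : ℝ} (hcD : 0 ≤ cD)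
    (hdcol : ∀ u ∈ Ω, ∑ i' : Ix N, ‖covDeriv C X' (propagatorK C Ω X msq a k (cb P N 0 (u, i'))) c‖ ≤ maj P k cD 1 δ c.src u)
    (u : HiggsLattice.Site P 0) :
    (P.mesh 0)⁻¹ * ∑ i : Ix N, ‖propagatorK C Ω X msq a k (dip C X' c (onb N i)) u‖
      ≤ maj P k ((Fintype.card (Ix N) : ℝ) * cD) 1 δ u c.src := by
  have hε : 0 < P.mesh 0 := P.mesh_pos 0
  have hN : 0 ≤ (Fintype.card (Ix N) : ℝ) := Nat.cast_nonneg _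
  by_cases hu : u ∈ Ω
  · have hper : ∀ i : Ix N, ‖propagatorK C Ω X msq a k (dip C X' c (onb N i)) u‖
        ≤ P.mesh 0 * ∑ i' : Ix N, ‖covDeriv C X' (propagatorK C Ω X msq a k (cb P N 0 (u, i'))) c‖ := fun i => by
      have h := B3Op116SourceForm.norm_propagatorK_dip_apply_le C Ω X X' msq a k c (onb N i) u
      rwa [norm_onb, mul_one] at h
    calc (P.mesh 0)⁻¹ * ∑ i : Ix N, ‖propagatorK C Ω X msq a k (dip C X' c (onb N i)) u‖
        ≤ (P.mesh 0)⁻¹ * ∑ _i : Ix N, P.mesh 0 * ∑ i' : Ix N, ‖covDeriv C X' (propagatorK C Ω X msq a k (cb P N 0 (u, i'))) c‖ :=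
          mul_le_mul_of_nonneg_left (Finset.sum_le_sum fun i _ => hper i) (inv_nonneg.mpr hε.le)
      _ = (Fintype.card (Ix N) : ℝ) * ∑ i' : Ix N, ‖covDeriv C X' (propagatorK C Ω X msq a k (cb P N 0 (u, i'))) c‖ := by
          rw [Finset.sum_const, Finset.card_univ, nsmul_eq_mul]; field_simp
      _ ≤ (Fintype.card (Ix N) : ℝ) * maj P k cD 1 δ c.src u := mul_le_mul_of_nonneg_left (hdcol u hu) hN
      _ = maj P k ((Fintype.card (Ix N) : ℝ) * cD) 1 δ u c.src := by rw [mul_maj, maj_comm]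
  · refine le_of_eq_of_le ?_ (maj_nonneg (mul_nonneg hN hcD) u c.src)
    rw [Finset.sum_eq_zero fun i _ => ?_, mul_zero]
    rw [dip, map_sub, Pi.sub_apply, B3Op116CollarSources.propagatorK_single_apply_eq_zero_of_mem C Ω X a hmsq hak hΩ hc.2 hu,
      B3Op116CollarSources.propagatorK_single_apply_eq_zero_of_mem C Ω X a hmsq hak hΩ hc.1 hu, sub_zero, norm_zero]

/-- **The `Y`-derivative at a collar bond of the dipole-sourced `(P+Y)`-states** (`P_c = 0` at the test bond, `sup|P| ≤ s`, `0 < δ ≤ 1`):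
`ε^{−1}Σ_i‖(D^ε_YG_k(Ω,X)dip^Y_ce_i)(b)‖ ≤ ε^{−1}Σ_i‖(D^ε_{P+Y}G_kdip^{P+Y}_ce_i)(b)‖ + |e|s·N·Σ_{i′}‖(D^ε_{P+Y}G_ke_{(b₊,i′)})(c)‖ ≤ 𝔪_k(c_m + e·c_D·L^kε·|e|s·N, 0; δ)(b₋,c₋)`.
[cite: Balaban1982Higgs1, (1.7) p.605, (3.14) p.614] [cite: Balaban1983Higgs3, (2.10) p.426, p.433] -/
theorem mixed_collar_dY_le_maj {δ s cm cD : ℝ} (hδ : 0 < δ) (hδ1 : δ ≤ 1) (hs : 0 ≤ s) (hcD : 0 ≤ cD)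
    (hP : ∀ b : HiggsLattice.PBond P 0, |Pf b| ≤ s) {b c : HiggsLattice.PBond P 0} (hc0 : Pf c = 0)
    (hmix : (P.mesh 0)⁻¹ * ∑ i : Ix N, ‖covDeriv C (Pf + Y) (propagatorK C Ω X msq a k (dip C (Pf + Y) c (onb N i))) b‖
      ≤ maj P k cm 0 δ b.src c.src)
    (hdcol : ∑ i' : Ix N, ‖covDeriv C (Pf + Y) (propagatorK C Ω X msq a k (cb P N 0 (b.tgt, i'))) c‖ ≤ maj P k cD 1 δ c.src b.tgt) :
    (P.mesh 0)⁻¹ * ∑ i : Ix N, ‖covDeriv C Y (propagatorK C Ω X msq a k (dip C Y c (onb N i))) b‖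
      ≤ maj P k (cm + Real.exp 1 * cD * P.mesh k * (|C.e| * s * (Fintype.card (Ix N) : ℝ))) 0 δ b.src c.src := by
  have hε : 0 < P.mesh 0 := P.mesh_pos 0
  have hes : 0 ≤ |C.e| * s := mul_nonneg (abs_nonneg _) hs
  have hN : 0 ≤ (Fintype.card (Ix N) : ℝ) := Nat.cast_nonneg _
  set κ : ℝ := ∑ i' : Ix N, ‖covDeriv C (Pf + Y) (propagatorK C Ω X msq a k (cb P N 0 (b.tgt, i'))) c‖ with hκ
  have hκ0 : 0 ≤ κ := Finset.sum_nonneg fun _ _ => norm_nonneg _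
  have hdipY : ∀ i : Ix N, dip C Y c (onb N i) = dip C (Pf + Y) c (onb N i) := fun i =>
    (B3Op116CollarDict.dip_congr_of_apply_eq C Pf Y hc0 (onb N i)).symm
  simp only [hdipY]
  have h1 := sum_norm_covDeriv_le_add C Pf Y (hP b) Finset.univ
    (fun i => propagatorK C Ω X msq a k (dip C (Pf + Y) c (onb N i)))
  have hval : ∀ i : Ix N, ‖propagatorK C Ω X msq a k (dip C (Pf + Y) c (onb N i)) b.tgt‖ ≤ P.mesh 0 * κ := fun i => by
    have h := B3Op116SourceForm.norm_propagatorK_dip_apply_le C Ω X (Pf + Y) msq a k c (onb N i) b.tgt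
    rwa [norm_onb, mul_one] at h
  have h2 : ∑ i : Ix N, ‖propagatorK C Ω X msq a k (dip C (Pf + Y) c (onb N i)) b.tgt‖ ≤ (Fintype.card (Ix N) : ℝ) * (P.mesh 0 * κ) := by
    refine (Finset.sum_le_sum fun i _ => hval i).trans (le_of_eq ?_)
    rw [Finset.sum_const, Finset.card_univ, nsmul_eq_mul]
  have hcol : κ ≤ maj P k (Real.exp 1 * cD * P.mesh k) 0 δ c.src b.src := by
    refine hdcol.trans ((maj_shift_right hδ hδ1 hcD c.src b.src b.dir).trans ?_)
    have h4 := maj_exponent_reduce (k := k) (a := (1 : ℝ)) (δ := δ) (mul_nonneg (Real.exp_pos 1).le hcD) c.src b.src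
    rwa [show (1 : ℝ) - 1 = 0 by norm_num] at h4
  calc (P.mesh 0)⁻¹ * ∑ i : Ix N, ‖covDeriv C Y (propagatorK C Ω X msq a k (dip C (Pf + Y) c (onb N i))) b‖
      ≤ (P.mesh 0)⁻¹ * (∑ i : Ix N, ‖covDeriv C (Pf + Y) (propagatorK C Ω X msq a k (dip C (Pf + Y) c (onb N i))) b‖
          + |C.e| * s * ((Fintype.card (Ix N) : ℝ) * (P.mesh 0 * κ))) :=
        mul_le_mul_of_nonneg_left (h1.trans (add_le_add le_rfl (mul_le_mul_of_nonneg_left h2 hes))) (inv_nonneg.mpr hε.le)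
    _ = (P.mesh 0)⁻¹ * ∑ i : Ix N, ‖covDeriv C (Pf + Y) (propagatorK C Ω X msq a k (dip C (Pf + Y) c (onb N i))) b‖
          + |C.e| * s * (Fintype.card (Ix N) : ℝ) * κ := by field_simp
    _ ≤ maj P k cm 0 δ b.src c.src + |C.e| * s * (Fintype.card (Ix N) : ℝ) * maj P k (Real.exp 1 * cD * P.mesh k) 0 δ c.src b.src :=
        add_le_add hmix (mul_le_mul_of_nonneg_left hcol (mul_nonneg hes hN))
    _ = maj P k (cm + Real.exp 1 * cD * P.mesh k * (|C.e| * s * (Fintype.card (Ix N) : ℝ))) 0 δ b.src c.src := by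
        rw [maj_comm k (Real.exp 1 * cD * P.mesh k), mul_maj, maj_add]; ring_nf

end ConvP

/-! ## §2 The value binders of `(1.16)_{1,0}` and `(1.16)_{0,1}` from the dictionary -/

section Binders

open scoped Classical

variable (C : ChargeData N) (Ω : Finset (HiggsLattice.Site P 0)) (Pf Y : HiggsLattice.VecField P 0) {msq : ℝ} (a : ℝ) {k : ℕ}
  (hmsq : 0 < msq) (hak : 0 ≤ B1.aSeq a P.L k)
  (hΩ : ∀ x x' : HiggsLattice.Site P 0, blockIter k x = blockIter k x' → (x ∈ Ω ↔ x' ∈ Ω))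
include hmsq hak hΩ

/-- **VALUE BINDER OF `(1.16)_{1,0}` FROM THE DICTIONARY** (`Ω` a `k`-block union, `x, x′ ∈ Ω` far from `supp P`; the (2.10) value
columns of `G_k(Ω,Y)` and `G_k(Ω,P+Y)` between points of `Ω` and their `Y`- resp. `(P+Y)`-differentiated columns at the bonds `⊂ Ω`, in
`maj` currency): `Σ_{i′}‖(G_k(Ω,Y)V_k^Ω(P,Y)G_k(Ω,P+Y)e_{(x′,i′)})(x)‖ ≤ top_k(farF·collarC(2,1,2; c_Y, c_Y^D, c_{PY}, c_{PY}^D + e·c_{PY}·L^kε·|e|s; …), 3; δ/4)(x,x′)`.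
[cite: Balaban1983Higgs3, (1.16) p.414, (2.10) p.426, p.433] [cite: Balaban1982Higgs1, (3.16) p.615, (3.44) p.619] -/
theorem value_binder_one_zero (hL2 : 2 ≤ P.L) (hkK : k ≤ P.K) {δ ρ : ℝ} (hδ : 0 < δ) (hδ1 : δ ≤ 1) (hρ : 1 ≤ ρ)
    {s cY cYd cPY cPYd : ℝ} (hs : 0 ≤ s) (hcY : 0 ≤ cY) (hcYd : 0 ≤ cYd) (hcPY : 0 ≤ cPY) (hcPYd : 0 ≤ cPYd)
    (hP : ∀ b : HiggsLattice.PBond P 0, |Pf b| ≤ s) (i₀ : Ix N)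
    (hcolY : ∀ u y : HiggsLattice.Site P 0, u ∈ Ω → y ∈ Ω →
      ∑ i : Ix N, ‖propagatorK C Ω Y msq a k (cb P N 0 (y, i)) u‖ ≤ maj P k cY 2 δ u y)
    (hdcolY : ∀ y ∈ Ω, ∀ b : HiggsLattice.PBond P 0, Inside Ω b →
      ∑ i : Ix N, ‖covDeriv C Y (propagatorK C Ω Y msq a k (cb P N 0 (y, i))) b‖ ≤ maj P k cYd 1 δ b.src y)
    (hcolPY : ∀ u y : HiggsLattice.Site P 0, u ∈ Ω → y ∈ Ω →
      ∑ i : Ix N, ‖propagatorK C Ω (Pf + Y) msq a k (cb P N 0 (y, i)) u‖ ≤ maj P k cPY 2 δ u y)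
    (hdcolPY : ∀ y ∈ Ω, ∀ b : HiggsLattice.PBond P 0, Inside Ω b →
      ∑ i : Ix N, ‖covDeriv C (Pf + Y) (propagatorK C Ω (Pf + Y) msq a k (cb P N 0 (y, i))) b‖ ≤ maj P k cPYd 1 δ b.src y)
    {x x' : HiggsLattice.Site P 0} (hx : x ∈ Ω) (hx' : x' ∈ Ω)
    (hfar : ∀ b : HiggsLattice.PBond P 0, Pf b ≠ 0 → ∀ z : HiggsLattice.Site P 0, blockIter k z = blockIter k b.src →
      Far P k ρ x z ∧ Far P k ρ z x') :
    ∑ i' : Ix N, ‖op116 C Ω Pf Y msq a k 1 0 (cb P N 0 (x', i')) x‖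
      ≤ top P k (farF P δ ρ * collarC P N k δ 2 1 2 cY cYd cPY (cPYd + Real.exp 1 * cPY * P.mesh k * (|C.e| * s))
            (|C.e| * s) 0 ((|C.e| * s) ^ 2) (|C.e| * s) 0
            (|B1.aSeq a P.L k| * (P.mesh k)⁻¹ ^ 2 *
              ((|C.e| * s * P.mesh 0 * (P.d * ((P.L : ℝ) ^ k - 1))) * (2 + |C.e| * s * P.mesh 0 * (P.d * ((P.L : ℝ) ^ k - 1))))))
          3 (δ / 4) x x' := by
  have hcd' : 0 ≤ cPYd + Real.exp 1 * cPY * P.mesh k * (|C.e| * s) := by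
    have := (Real.exp_pos 1).le; have := (P.mesh_pos k).le; have := abs_nonneg C.e; positivity
  refine value_row_op116_one_zero_le C Ω Pf Y msq a hL2 hkK hδ hδ1 hρ hs hcY hcYd hcPY hcd' hP i₀ x x'
    (col_row_all C Ω Y a hmsq hak hΩ hx hcY fun y hy => hcolY x y hx hy) (fun b hb => hdcolY x hx b (mem_collB.1 hb).1)
    (col_state_all C Ω (Pf + Y) a hmsq hak hΩ hx' hcPY fun u hu => hcolPY u x' hu hx') (fun b hb => ?_) hfar
  have hIn : Inside Ω b := (mem_collB.1 hb).1
  exact sum_dY_le_maj C Pf Y hδ hδ1 hs hcPY hP Finset.univ (fun i' => propagatorK C Ω (Pf + Y) msq a k (cb P N 0 (x', i'))) b x'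
    (hdcolPY x' hx' b hIn) (hcolPY b.tgt x' hIn.2 hx')

/-- **VALUE BINDER OF `(1.16)_{0,1}` FROM THE DICTIONARY** (outer `G_k(Ω,P+Y)` from `x`, inner `G_k(Ω,Y)` from `x′`).
[cite: Balaban1983Higgs3, (1.16) p.414, (2.10) p.426, p.433] [cite: Balaban1982Higgs1, (3.16) p.615, (3.44) p.619] -/
theorem value_binder_zero_one (hL2 : 2 ≤ P.L) (hkK : k ≤ P.K) {δ ρ : ℝ} (hδ : 0 < δ) (hδ1 : δ ≤ 1) (hρ : 1 ≤ ρ)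
    {s cY cYd cPY cPYd : ℝ} (hs : 0 ≤ s) (hcY : 0 ≤ cY) (hcYd : 0 ≤ cYd) (hcPY : 0 ≤ cPY) (hcPYd : 0 ≤ cPYd)
    (hP : ∀ b : HiggsLattice.PBond P 0, |Pf b| ≤ s) (i₀ : Ix N)
    (hcolY : ∀ u y : HiggsLattice.Site P 0, u ∈ Ω → y ∈ Ω →
      ∑ i : Ix N, ‖propagatorK C Ω Y msq a k (cb P N 0 (y, i)) u‖ ≤ maj P k cY 2 δ u y)
    (hdcolY : ∀ y ∈ Ω, ∀ b : HiggsLattice.PBond P 0, Inside Ω b →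
      ∑ i : Ix N, ‖covDeriv C Y (propagatorK C Ω Y msq a k (cb P N 0 (y, i))) b‖ ≤ maj P k cYd 1 δ b.src y)
    (hcolPY : ∀ u y : HiggsLattice.Site P 0, u ∈ Ω → y ∈ Ω →
      ∑ i : Ix N, ‖propagatorK C Ω (Pf + Y) msq a k (cb P N 0 (y, i)) u‖ ≤ maj P k cPY 2 δ u y)
    (hdcolPY : ∀ y ∈ Ω, ∀ b : HiggsLattice.PBond P 0, Inside Ω b →
      ∑ i : Ix N, ‖covDeriv C (Pf + Y) (propagatorK C Ω (Pf + Y) msq a k (cb P N 0 (y, i))) b‖ ≤ maj P k cPYd 1 δ b.src y)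
    {x x' : HiggsLattice.Site P 0} (hx : x ∈ Ω) (hx' : x' ∈ Ω)
    (hfar : ∀ b : HiggsLattice.PBond P 0, Pf b ≠ 0 → ∀ z : HiggsLattice.Site P 0, blockIter k z = blockIter k b.src →
      Far P k ρ x z ∧ Far P k ρ z x') :
    ∑ i' : Ix N, ‖op116 C Ω Pf Y msq a k 0 1 (cb P N 0 (x', i')) x‖
      ≤ top P k (farF P δ ρ * collarC P N k δ 2 1 2 cPY (cPYd + Real.exp 1 * cPY * P.mesh k * (|C.e| * s)) cY cYd
            (|C.e| * s) 0 ((|C.e| * s) ^ 2) (|C.e| * s) 0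
            (|B1.aSeq a P.L k| * (P.mesh k)⁻¹ ^ 2 *
              ((|C.e| * s * P.mesh 0 * (P.d * ((P.L : ℝ) ^ k - 1))) * (2 + |C.e| * s * P.mesh 0 * (P.d * ((P.L : ℝ) ^ k - 1))))))
          3 (δ / 4) x x' := by
  have hcKd' : 0 ≤ cPYd + Real.exp 1 * cPY * P.mesh k * (|C.e| * s) := by
    have := (Real.exp_pos 1).le; have := (P.mesh_pos k).le; have := abs_nonneg C.e; positivity
  refine value_row_op116_zero_one_le C Ω Pf Y msq a hL2 hkK hδ hδ1 hρ hs hcPY hcKd' hcY hcYd hP i₀ x x'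
    (col_row_all C Ω (Pf + Y) a hmsq hak hΩ hx hcPY fun y hy => hcolPY x y hx hy) (fun b hb => ?_)
    (col_state_all C Ω Y a hmsq hak hΩ hx' hcY fun u hu => hcolY u x' hu hx') (fun b hb => hdcolY x' hx' b (mem_collB.1 hb).1) hfar
  have hIn : Inside Ω b := (mem_collB.1 hb).1
  exact sum_dY_le_maj C Pf Y hδ hδ1 hs hcPY hP Finset.univ (fun i => propagatorK C Ω (Pf + Y) msq a k (cb P N 0 (x, i))) b x
    (hdcolPY x hx b hIn) (hcolPY b.tgt x hIn.2 hx)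

/-! ## §3 The row-derivative binders of `(1.16)_{1,0}` and `(1.16)_{0,1}` from the dictionary -/

/-- **ROW-DERIVATIVE BINDER OF `(1.16)_{1,0}` FROM THE DICTIONARY** at a bond `b₀ ⊂ Ω` whose initial point is far from `supp P`, GIVEN in
addition the twice-differentiated (mixed) entries of `G_k(Ω,Y)` between bonds `⊂ Ω` (p40's `mixed_le_of_pieces` shape):
`Σ_{i′}‖(D^ε_YG_k(Ω,Y)V_k^Ω(P,Y)G_k(Ω,P+Y)e_{(x′,i′)})(b₀)‖ ≤ top_k(farF·collarC(1,0,2; c_Y^D, c_Y^M, c_{PY}, c_{PY}^D + e·c_{PY}·L^kε·|e|s; …), 2; δ/4)(b₀₋,x′)`.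
[cite: Balaban1983Higgs3, (1.16) p.414, (2.10) p.426, p.433] [cite: Balaban1982Higgs1, (3.16) p.615, (3.44) p.619] -/
theorem deriv_binder_one_zero (hL2 : 2 ≤ P.L) (hkK : k ≤ P.K) {δ ρ : ℝ} (hδ : 0 < δ) (hδ1 : δ ≤ 1) (hρ : 1 ≤ ρ)
    {s cYd cYm cPY cPYd : ℝ} (hs : 0 ≤ s) (hcYd : 0 ≤ cYd) (hcYm : 0 ≤ cYm) (hcPY : 0 ≤ cPY) (hcPYd : 0 ≤ cPYd)
    (hP : ∀ b : HiggsLattice.PBond P 0, |Pf b| ≤ s) (i₀ : Ix N)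
    (hdcolY : ∀ y ∈ Ω, ∀ b : HiggsLattice.PBond P 0, Inside Ω b →
      ∑ i : Ix N, ‖covDeriv C Y (propagatorK C Ω Y msq a k (cb P N 0 (y, i))) b‖ ≤ maj P k cYd 1 δ b.src y)
    (hmixY : ∀ b b' : HiggsLattice.PBond P 0, Inside Ω b → Inside Ω b' →
      (P.mesh 0)⁻¹ * ∑ i : Ix N, ‖covDeriv C Y (propagatorK C Ω Y msq a k (dip C Y b' (onb N i))) b‖ ≤ maj P k cYm 0 δ b.src b'.src)
    (hcolPY : ∀ u y : HiggsLattice.Site P 0, u ∈ Ω → y ∈ Ω →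
      ∑ i : Ix N, ‖propagatorK C Ω (Pf + Y) msq a k (cb P N 0 (y, i)) u‖ ≤ maj P k cPY 2 δ u y)
    (hdcolPY : ∀ y ∈ Ω, ∀ b : HiggsLattice.PBond P 0, Inside Ω b →
      ∑ i : Ix N, ‖covDeriv C (Pf + Y) (propagatorK C Ω (Pf + Y) msq a k (cb P N 0 (y, i))) b‖ ≤ maj P k cPYd 1 δ b.src y)
    {b₀ : HiggsLattice.PBond P 0} (hb₀ : Inside Ω b₀) {x' : HiggsLattice.Site P 0} (hx' : x' ∈ Ω)
    (hfar : ∀ b : HiggsLattice.PBond P 0, Pf b ≠ 0 → ∀ z : HiggsLattice.Site P 0, blockIter k z = blockIter k b.src →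
      Far P k ρ b₀.src z ∧ Far P k ρ z x') :
    ∑ i' : Ix N, ‖covDeriv C Y (op116 C Ω Pf Y msq a k 1 0 (cb P N 0 (x', i'))) b₀‖
      ≤ top P k (farF P δ ρ * collarC P N k δ 1 0 2 cYd cYm cPY (cPYd + Real.exp 1 * cPY * P.mesh k * (|C.e| * s))
            (|C.e| * s) 0 ((|C.e| * s) ^ 2) (|C.e| * s) 0
            (|B1.aSeq a P.L k| * (P.mesh k)⁻¹ ^ 2 *
              ((|C.e| * s * P.mesh 0 * (P.d * ((P.L : ℝ) ^ k - 1))) * (2 + |C.e| * s * P.mesh 0 * (P.d * ((P.L : ℝ) ^ k - 1))))))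
          2 (δ / 4) b₀.src x' := by
  have hcd' : 0 ≤ cPYd + Real.exp 1 * cPY * P.mesh k * (|C.e| * s) := by
    have := (Real.exp_pos 1).le; have := (P.mesh_pos k).le; have := abs_nonneg C.e; positivity
  refine deriv_row_op116_one_zero_le C Ω Pf Y msq a hL2 hkK hδ hδ1 hρ hs hcYd hcYm hcPY hcd' hP i₀ b₀ x'
    (dcol_row_all C Ω Y a hmsq hak hΩ Y hb₀ hcYd fun y hy => hdcolY y hy b₀ hb₀)
    (fun b hb => by rw [maj_comm]; exact hmixY b₀ b hb₀ (mem_collB.1 hb).1)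
    (col_state_all C Ω (Pf + Y) a hmsq hak hΩ hx' hcPY fun u hu => hcolPY u x' hu hx') (fun b hb => ?_) hfar
  have hIn : Inside Ω b := (mem_collB.1 hb).1
  exact sum_dY_le_maj C Pf Y hδ hδ1 hs hcPY hP Finset.univ (fun i' => propagatorK C Ω (Pf + Y) msq a k (cb P N 0 (x', i'))) b x'
    (hdcolPY x' hx' b hIn) (hcolPY b.tgt x' hIn.2 hx')

/-- **ROW-DERIVATIVE BINDER OF `(1.16)_{0,1}` FROM THE DICTIONARY** at a bond `b₀ ⊂ Ω` whose initial point is far from `supp P` (so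
`P_{b₀} = 0` and `D^ε_Y = D^ε_{P+Y}` at `b₀`), GIVEN the mixed entries of `G_k(Ω,P+Y)`:
`Σ_{i′}‖(D^ε_YG_k(Ω,P+Y)V_k^Ω(P,Y)G_k(Ω,Y)e_{(x′,i′)})(b₀)‖ ≤ top_k(farF·collarC(1,0,2; c_{PY}^D, c_{PY}^M + e·c_{PY}^D·L^kε·|e|s·N, c_Y, c_Y^D; …), 2; δ/4)(b₀₋,x′)`.
[cite: Balaban1983Higgs3, (1.16) p.414, (2.10) p.426, p.433] [cite: Balaban1982Higgs1, (3.16) p.615, (3.44) p.619] -/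
theorem deriv_binder_zero_one (hL2 : 2 ≤ P.L) (hkK : k ≤ P.K) {δ ρ : ℝ} (hδ : 0 < δ) (hδ1 : δ ≤ 1) (hρ : 1 ≤ ρ)
    {s cY cYd cPYd cPYm : ℝ} (hs : 0 ≤ s) (hcY : 0 ≤ cY) (hcYd : 0 ≤ cYd) (hcPYd : 0 ≤ cPYd) (hcPYm : 0 ≤ cPYm)
    (hP : ∀ b : HiggsLattice.PBond P 0, |Pf b| ≤ s) (i₀ : Ix N)
    (hcolY : ∀ u y : HiggsLattice.Site P 0, u ∈ Ω → y ∈ Ω →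
      ∑ i : Ix N, ‖propagatorK C Ω Y msq a k (cb P N 0 (y, i)) u‖ ≤ maj P k cY 2 δ u y)
    (hdcolY : ∀ y ∈ Ω, ∀ b : HiggsLattice.PBond P 0, Inside Ω b →
      ∑ i : Ix N, ‖covDeriv C Y (propagatorK C Ω Y msq a k (cb P N 0 (y, i))) b‖ ≤ maj P k cYd 1 δ b.src y)
    (hdcolPY : ∀ y ∈ Ω, ∀ b : HiggsLattice.PBond P 0, Inside Ω b →
      ∑ i : Ix N, ‖covDeriv C (Pf + Y) (propagatorK C Ω (Pf + Y) msq a k (cb P N 0 (y, i))) b‖ ≤ maj P k cPYd 1 δ b.src y)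
    (hmixPY : ∀ b b' : HiggsLattice.PBond P 0, Inside Ω b → Inside Ω b' →
      (P.mesh 0)⁻¹ * ∑ i : Ix N, ‖covDeriv C (Pf + Y) (propagatorK C Ω (Pf + Y) msq a k (dip C (Pf + Y) b' (onb N i))) b‖
        ≤ maj P k cPYm 0 δ b.src b'.src)
    {b₀ : HiggsLattice.PBond P 0} (hb₀ : Inside Ω b₀) {x' : HiggsLattice.Site P 0} (hx' : x' ∈ Ω)
    (hfar : ∀ b : HiggsLattice.PBond P 0, Pf b ≠ 0 → ∀ z : HiggsLattice.Site P 0, blockIter k z = blockIter k b.src →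
      Far P k ρ b₀.src z ∧ Far P k ρ z x') :
    ∑ i' : Ix N, ‖covDeriv C Y (op116 C Ω Pf Y msq a k 0 1 (cb P N 0 (x', i'))) b₀‖
      ≤ top P k (farF P δ ρ * collarC P N k δ 1 0 2 cPYd
            (cPYm + Real.exp 1 * cPYd * P.mesh k * (|C.e| * s * (Fintype.card (Ix N) : ℝ))) cY cYd
            (|C.e| * s) 0 ((|C.e| * s) ^ 2) (|C.e| * s) 0
            (|B1.aSeq a P.L k| * (P.mesh k)⁻¹ ^ 2 *
              ((|C.e| * s * P.mesh 0 * (P.d * ((P.L : ℝ) ^ k - 1))) * (2 + |C.e| * s * P.mesh 0 * (P.d * ((P.L : ℝ) ^ k - 1))))))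
          2 (δ / 4) b₀.src x' := by
  have hρ0 : 0 < ρ := zero_lt_one.trans_le hρ
  have hP0 : Pf b₀ = 0 := apply_eq_zero_of_far_src hρ0 hfar rfl
  have hcKd' : 0 ≤ cPYm + Real.exp 1 * cPYd * P.mesh k * (|C.e| * s * (Fintype.card (Ix N) : ℝ)) := by
    have := (Real.exp_pos 1).le; have := (P.mesh_pos k).le; have := abs_nonneg C.e; positivity
  refine deriv_row_op116_zero_one_le C Ω Pf Y msq a hL2 hkK hδ hδ1 hρ hs hcPYd hcKd' hcY hcYd hP i₀ b₀ x' (fun y => ?_)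
    (fun b hb => ?_) (col_state_all C Ω Y a hmsq hak hΩ hx' hcY fun u hu => hcolY u x' hu hx')
    (fun b hb => hdcolY x' hx' b (mem_collB.1 hb).1) hfar
  · -- `D^ε_Y = D^ε_{P+Y}` at `b₀`, then the `(P+Y)` differentiated column (all sources)
    have h := dcol_row_all C Ω (Pf + Y) a hmsq hak hΩ (Pf + Y) hb₀ hcPYd (fun y hy => hdcolPY y hy b₀ hb₀) y
    refine le_of_eq_of_le (Finset.sum_congr rfl fun i _ => ?_) h
    rw [covDeriv_eq_covDeriv_add C Pf Y hP0]
  · have hIn : Inside Ω b := (mem_collB.1 hb).1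
    exact mixed_dY_le_maj C Pf Y Ω (Pf + Y) msq a hδ hδ1 hs hcPYd hP hP0 (hmixPY b₀ b hb₀ hIn) (hdcolPY b.tgt hIn.2 b₀ hb₀)


/-! ## §4 The mixed binders of `(1.16)_{1,0}` and `(1.16)_{0,1}` from the dictionary -/

/-- **MIXED BINDER OF `(1.16)_{1,0}` FROM THE DICTIONARY** at bonds `b₀, c ⊂ Ω` whose initial points are far from `supp P` (so `P_c = 0`):
`ε^{−1}Σ_i‖(D^ε_YG_k(Ω,Y)V_k^Ω(P,Y)G_k(Ω,P+Y)dip^Y_ce_i)(b₀)‖ ≤ top_k(farF·collarC(1,0,1; c_Y^D, c_Y^M, N·c_{PY}^D, c_{PY}^M + e·c_{PY}^D·L^kε·|e|s·N; …), 1; δ/4)(b₀₋,c₋)`.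
[cite: Balaban1983Higgs3, (1.16) p.414, (2.10) p.426, p.433] [cite: Balaban1982Higgs1, (1.7) p.605, (3.16) p.615, (3.44) p.619] -/
theorem mixed_binder_one_zero (hL2 : 2 ≤ P.L) (hkK : k ≤ P.K) {δ ρ : ℝ} (hδ : 0 < δ) (hδ1 : δ ≤ 1) (hρ : 1 ≤ ρ)
    {s cYd cYm cPYd cPYm : ℝ} (hs : 0 ≤ s) (hcYd : 0 ≤ cYd) (hcYm : 0 ≤ cYm) (hcPYd : 0 ≤ cPYd) (hcPYm : 0 ≤ cPYm)
    (hP : ∀ b : HiggsLattice.PBond P 0, |Pf b| ≤ s) (i₀ : Ix N)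
    (hdcolY : ∀ y ∈ Ω, ∀ b : HiggsLattice.PBond P 0, Inside Ω b →
      ∑ i : Ix N, ‖covDeriv C Y (propagatorK C Ω Y msq a k (cb P N 0 (y, i))) b‖ ≤ maj P k cYd 1 δ b.src y)
    (hmixY : ∀ b b' : HiggsLattice.PBond P 0, Inside Ω b → Inside Ω b' →
      (P.mesh 0)⁻¹ * ∑ i : Ix N, ‖covDeriv C Y (propagatorK C Ω Y msq a k (dip C Y b' (onb N i))) b‖ ≤ maj P k cYm 0 δ b.src b'.src)
    (hdcolPY : ∀ y ∈ Ω, ∀ b : HiggsLattice.PBond P 0, Inside Ω b →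
      ∑ i : Ix N, ‖covDeriv C (Pf + Y) (propagatorK C Ω (Pf + Y) msq a k (cb P N 0 (y, i))) b‖ ≤ maj P k cPYd 1 δ b.src y)
    (hmixPY : ∀ b b' : HiggsLattice.PBond P 0, Inside Ω b → Inside Ω b' →
      (P.mesh 0)⁻¹ * ∑ i : Ix N, ‖covDeriv C (Pf + Y) (propagatorK C Ω (Pf + Y) msq a k (dip C (Pf + Y) b' (onb N i))) b‖
        ≤ maj P k cPYm 0 δ b.src b'.src)
    {b₀ c : HiggsLattice.PBond P 0} (hb₀ : Inside Ω b₀) (hc : Inside Ω c)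
    (hfar : ∀ b : HiggsLattice.PBond P 0, Pf b ≠ 0 → ∀ z : HiggsLattice.Site P 0, blockIter k z = blockIter k b.src →
      Far P k ρ b₀.src z ∧ Far P k ρ z c.src) :
    (P.mesh 0)⁻¹ * ∑ i : Ix N, ‖covDeriv C Y (op116 C Ω Pf Y msq a k 1 0 (dip C Y c (onb N i))) b₀‖
      ≤ top P k (farF P δ ρ * collarC P N k δ 1 0 1 cYd cYm ((Fintype.card (Ix N) : ℝ) * cPYd)
            (cPYm + Real.exp 1 * cPYd * P.mesh k * (|C.e| * s * (Fintype.card (Ix N) : ℝ)))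
            (|C.e| * s) 0 ((|C.e| * s) ^ 2) (|C.e| * s) 0
            (|B1.aSeq a P.L k| * (P.mesh k)⁻¹ ^ 2 *
              ((|C.e| * s * P.mesh 0 * (P.d * ((P.L : ℝ) ^ k - 1))) * (2 + |C.e| * s * P.mesh 0 * (P.d * ((P.L : ℝ) ^ k - 1))))))
          1 (δ / 4) b₀.src c.src := by
  have hρ0 : 0 < ρ := zero_lt_one.trans_le hρ
  have hPc : Pf c = 0 := B3Op116CollarDict.apply_eq_zero_of_far_tgt hρ0 hfar rfl
  have hN : 0 ≤ (Fintype.card (Ix N) : ℝ) := Nat.cast_nonneg _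
  have hcd' : 0 ≤ cPYm + Real.exp 1 * cPYd * P.mesh k * (|C.e| * s * (Fintype.card (Ix N) : ℝ)) := by
    have := (Real.exp_pos 1).le; have := (P.mesh_pos k).le; have := abs_nonneg C.e; positivity
  refine B3Op116CollarKernel.mixed_row_op116_one_zero_le C Ω Pf Y msq a hL2 hkK hδ hδ1 hρ hs hcYd hcYm (mul_nonneg hN hcPYd) hcd' hP
    i₀ b₀ c (dcol_row_all C Ω Y a hmsq hak hΩ Y hb₀ hcYd fun y hy => hdcolY y hy b₀ hb₀)
    (fun b hb => by rw [maj_comm]; exact hmixY b₀ b hb₀ (mem_collB.1 hb).1) (fun u => ?_) (fun b hb => ?_) hfar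
  · -- the dipole-sourced `(P+Y)`-states read anywhere: a `Y`-differentiated column of `G_{P+Y}` at the central bond `c` (`D_Y = D_{P+Y}` there)
    refine dip_state_all C Ω (Pf + Y) msq a hmsq hak hΩ Y hc hcPYd (fun u hu => ?_) u
    have h := hdcolPY u hu c hc
    refine le_of_eq_of_le (Finset.sum_congr rfl fun i _ => ?_) h
    rw [covDeriv_eq_covDeriv_add C Pf Y hPc]
  · have hIn : Inside Ω b := (mem_collB.1 hb).1
    exact mixed_collar_dY_le_maj C Pf Y Ω (Pf + Y) msq a hδ hδ1 hs hcPYd hP hPc (hmixPY b c hIn hc) (hdcolPY b.tgt hIn.2 c hc)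

/-- **MIXED BINDER OF `(1.16)_{0,1}` FROM THE DICTIONARY** at bonds `b₀, c ⊂ Ω` whose initial points are far from `supp P` (`P_{b₀} = 0`):
`ε^{−1}Σ_i‖(D^ε_YG_k(Ω,P+Y)V_k^Ω(P,Y)G_k(Ω,Y)dip^Y_ce_i)(b₀)‖ ≤ top_k(farF·collarC(1,0,1; c_{PY}^D, c_{PY}^M + e·c_{PY}^D·L^kε·|e|s·N, N·c_Y^D, c_Y^M; …), 1; δ/4)(b₀₋,c₋)`.
[cite: Balaban1983Higgs3, (1.16) p.414, (2.10) p.426, p.433] [cite: Balaban1982Higgs1, (1.7) p.605, (3.16) p.615, (3.44) p.619] -/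
theorem mixed_binder_zero_one (hL2 : 2 ≤ P.L) (hkK : k ≤ P.K) {δ ρ : ℝ} (hδ : 0 < δ) (hδ1 : δ ≤ 1) (hρ : 1 ≤ ρ)
    {s cYd cYm cPYd cPYm : ℝ} (hs : 0 ≤ s) (hcYd : 0 ≤ cYd) (hcYm : 0 ≤ cYm) (hcPYd : 0 ≤ cPYd) (hcPYm : 0 ≤ cPYm)
    (hP : ∀ b : HiggsLattice.PBond P 0, |Pf b| ≤ s) (i₀ : Ix N)
    (hdcolY : ∀ y ∈ Ω, ∀ b : HiggsLattice.PBond P 0, Inside Ω b →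
      ∑ i : Ix N, ‖covDeriv C Y (propagatorK C Ω Y msq a k (cb P N 0 (y, i))) b‖ ≤ maj P k cYd 1 δ b.src y)
    (hmixY : ∀ b b' : HiggsLattice.PBond P 0, Inside Ω b → Inside Ω b' →
      (P.mesh 0)⁻¹ * ∑ i : Ix N, ‖covDeriv C Y (propagatorK C Ω Y msq a k (dip C Y b' (onb N i))) b‖ ≤ maj P k cYm 0 δ b.src b'.src)
    (hdcolPY : ∀ y ∈ Ω, ∀ b : HiggsLattice.PBond P 0, Inside Ω b →
      ∑ i : Ix N, ‖covDeriv C (Pf + Y) (propagatorK C Ω (Pf + Y) msq a k (cb P N 0 (y, i))) b‖ ≤ maj P k cPYd 1 δ b.src y)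
    (hmixPY : ∀ b b' : HiggsLattice.PBond P 0, Inside Ω b → Inside Ω b' →
      (P.mesh 0)⁻¹ * ∑ i : Ix N, ‖covDeriv C (Pf + Y) (propagatorK C Ω (Pf + Y) msq a k (dip C (Pf + Y) b' (onb N i))) b‖
        ≤ maj P k cPYm 0 δ b.src b'.src)
    {b₀ c : HiggsLattice.PBond P 0} (hb₀ : Inside Ω b₀) (hc : Inside Ω c)
    (hfar : ∀ b : HiggsLattice.PBond P 0, Pf b ≠ 0 → ∀ z : HiggsLattice.Site P 0, blockIter k z = blockIter k b.src →
      Far P k ρ b₀.src z ∧ Far P k ρ z c.src) :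
    (P.mesh 0)⁻¹ * ∑ i : Ix N, ‖covDeriv C Y (op116 C Ω Pf Y msq a k 0 1 (dip C Y c (onb N i))) b₀‖
      ≤ top P k (farF P δ ρ * collarC P N k δ 1 0 1 cPYd
            (cPYm + Real.exp 1 * cPYd * P.mesh k * (|C.e| * s * (Fintype.card (Ix N) : ℝ)))
            ((Fintype.card (Ix N) : ℝ) * cYd) cYm
            (|C.e| * s) 0 ((|C.e| * s) ^ 2) (|C.e| * s) 0
            (|B1.aSeq a P.L k| * (P.mesh k)⁻¹ ^ 2 *
              ((|C.e| * s * P.mesh 0 * (P.d * ((P.L : ℝ) ^ k - 1))) * (2 + |C.e| * s * P.mesh 0 * (P.d * ((P.L : ℝ) ^ k - 1))))))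
          1 (δ / 4) b₀.src c.src := by
  have hρ0 : 0 < ρ := zero_lt_one.trans_le hρ
  have hP0 : Pf b₀ = 0 := apply_eq_zero_of_far_src hρ0 hfar rfl
  have hN : 0 ≤ (Fintype.card (Ix N) : ℝ) := Nat.cast_nonneg _
  have hcKd' : 0 ≤ cPYm + Real.exp 1 * cPYd * P.mesh k * (|C.e| * s * (Fintype.card (Ix N) : ℝ)) := by
    have := (Real.exp_pos 1).le; have := (P.mesh_pos k).le; have := abs_nonneg C.e; positivity
  refine B3Op116CollarKernel.mixed_row_op116_zero_one_le C Ω Pf Y msq a hL2 hkK hδ hδ1 hρ hs hcPYd hcKd' (mul_nonneg hN hcYd) hcYm hP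
    i₀ b₀ c (fun y => ?_) (fun b hb => ?_)
    (dip_state_all C Ω Y msq a hmsq hak hΩ Y hc hcYd (fun u hu => hdcolY u hu c hc))
    (fun b hb => hmixY b c (mem_collB.1 hb).1 hc) hfar
  · have h := dcol_row_all C Ω (Pf + Y) a hmsq hak hΩ (Pf + Y) hb₀ hcPYd (fun y hy => hdcolPY y hy b₀ hb₀) y
    refine le_of_eq_of_le (Finset.sum_congr rfl fun i _ => ?_) h
    rw [covDeriv_eq_covDeriv_add C Pf Y hP0]
  · have hIn : Inside Ω b := (mem_collB.1 hb).1
    exact mixed_dY_le_maj C Pf Y Ω (Pf + Y) msq a hδ hδ1 hs hcPYd hP hP0 (hmixPY b₀ b hb₀ hIn) (hdcolPY b.tgt hIn.2 b₀ hb₀)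

end Binders

end Literature.MathematicalPhysics.QuantumFieldTheory.Balaban1983to89.B3Op116CollarBinders

end
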